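import Literature.MathematicalPhysics.QuantumFieldTheory.Federbush1986.AbelianModeEstimates

/-!
# `Federbush1986.LatticeRiemannSums` — lattice sums `Σ_{b∈ℤ⁴} ℓ_r⁴ c_r(b)` converge to `∫_{ℝ⁴}` under an integrable
# envelope (dominated convergence of lattice Riemann sums): binder-free infrastructure for [Federbush1987PhaseCellVI]
# Theorem 2 p. 20 and [Federbush1986PhaseCellI] §4 p. 329 («the lattice actions S^r_0 approach the continuum action»);
# theorems + plumbing definitions only

statement-level skeleton of published theorems with citation tags; proofs where landed; nothing here is a claim about the Yang–Mills mass gap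

CITATION HEADER.  P. Federbush, *A phase cell approach to Yang–Mills theory. VI. Non-abelian lattice-continuum duality*,
Ann. Inst. H. Poincaré (Physique théorique) **47** (1987) 17–23 [Federbush1987PhaseCellVI], Theorem 2 p. 20: *«Then, for the
compatible set of lattice assignments associated to A_μ(x), the corresponding lattice actions, S^r_0, converge to the
continuum action as r → ∞.»* (with (10) «S^r_0 = ¼Σ_p|g_∂p|²», a sum over the plaquettes of the level-`r` lattice of edge
`ℓ_r = 2^{−r}`, and the continuum action «½∫(dA + A∧A)²», p. 18); P. Federbush, *… I. Modes, lattice-continuum duality*,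
Commun. Math. Phys. **107** (1986) 319–329 [Federbush1986PhaseCellI], §4 p. 329: *«it is straightforward to show the lattice
actions S^r_0 approach the continuum action as r → ∞.»*  Unit `lit-balaban-r17` gen 3 (fold owner of the Federbush block);
SKELETON rows **F6.Thm2** and **F1.Sect§4** of `run/shared/lean/pub/lit-balaban/lit-balaban-r17/SKELETON-r17.md` (both
untouched as rows; this module is the common analytic step of their proofs, independent of the typing notes T-F6-1/T-F6-2).

THE MATHEMATICS (the step both convergence statements rest on).  A plaquette sum at level `r` is a sum over base points
`b ∈ ℤ⁴` (and finitely many direction pairs) of terms `≈ ℓ_r⁴ · density(ℓ_r b)`; its convergence to `∫ density` is the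
convergence of the integrals of the BOX-STEP FUNCTIONS `x ↦ c_r(⌊x/ℓ_r⌋)` — whose integral over `ℝ⁴` IS `ℓ_r⁴ Σ_b c_r(b)`
(`integral_stepFun`, from `MeasureTheory.integral_tsum` over the countable box partition and `vol(box) = ℓ⁴`) — to `∫ F`
when `c_r(⌊x/ℓ_r⌋) → F(x)` pointwise under an integrable envelope `G` (Lebesgue dominated convergence):
`tendsto_latticeSum_of_dominated`.  The form with `c_r(b) = h(ℓ_r b)` for a continuous `h` dominated by an antitone radial
profile `g(‖x‖)` with `x ↦ g(‖x‖ − 2)` integrable (e.g. Theorem 2's decay `|x|^{−(4+2ε)} ∧ const`) is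
`tendsto_latticeSum_continuous`; error terms are handled by the general form with `F = 0`.

WHAT THIS MODULE PROVIDES (no `Prop` definition, no named fact; axioms standard).  Plumbing defs `floorIdx`, `latBox`,
`cornerPt`, `stepFun`; theorems `mem_latBox_iff`, `measurableSet_latBox`, `volume_latBox` (`= ℓ⁴`), `measurable_stepFun`,
`lintegral_enorm_stepFun`, `integral_stepFun` (`∫ stepFun = Σ' ℓ⁴ c b`), `norm_sub_cornerPt_le` (`‖x − ℓ⌊x/ℓ⌋‖ ≤ 2ℓ`),
`tendsto_cornerPt` , **`tendsto_latticeSum_of_dominated`**, **`tendsto_latticeSum_continuous`**.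
-/

namespace Literature.MathematicalPhysics.QuantumFieldTheory.Federbush1986

noncomputable section

open MeasureTheory Filter Set
open scoped Topology BigOperators ENNReal

namespace LatticeRiemann

/-! ## §1 Lattice boxes of side `ℓ` and their volume -/

/-- The index `⌊x/ℓ⌋ ∈ ℤ⁴` of the half-open lattice box of side `ℓ` containing `x` (base points of the level-`r` lattice,
`ℓ = ℓ_r`). [cite: Federbush1987PhaseCellVI, (10) p. 20] -/
def floorIdx (ℓ : ℝ) (x : E4) : Fin 4 → ℤ := fun i => ⌊x i / ℓ⌋

/-- The half-open lattice box `ℓb + [0, ℓ)⁴`. [cite: Federbush1987PhaseCellVI, (10) p. 20] -/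
def latBox (ℓ : ℝ) (b : Fin 4 → ℤ) : Set E4 := {x | ∀ i, ℓ * b i ≤ x i ∧ x i < ℓ * (b i + 1)}

/-- The lattice point `ℓb ∈ ℓℤ⁴` (lower corner of `latBox ℓ b`). [cite: Federbush1987PhaseCellVI, (10) p. 20] -/
def cornerPt (ℓ : ℝ) (b : Fin 4 → ℤ) : E4 := mkPt fun i => ℓ * b i

/-- The box-step function with value `c b` on `latBox ℓ b`. [cite: Federbush1987PhaseCellVI, (10) p. 20] -/
def stepFun (ℓ : ℝ) (c : (Fin 4 → ℤ) → ℝ) : E4 → ℝ := fun x => c (floorIdx ℓ x)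

variable {ℓ : ℝ} {b : Fin 4 → ℤ} {c : (Fin 4 → ℤ) → ℝ}

/-- `⌊x/ℓ⌋` is measurable. [cite: Federbush1987PhaseCellVI, (10) p. 20] -/
theorem measurable_floorIdx (ℓ : ℝ) : Measurable (floorIdx ℓ) := by
  refine measurable_pi_iff.2 fun i => ?_
  have h1 : Measurable fun x : E4 => x i := ((continuous_apply i).comp (PiLp.continuous_ofLp 2 _)).measurable
  exact Int.measurable_floor.comp (h1.div_const ℓ)

/-- `x ∈ ℓb + [0, ℓ)⁴ ↔ ⌊x/ℓ⌋ = b` (`ℓ > 0`). [cite: Federbush1987PhaseCellVI, (10) p. 20] -/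
theorem mem_latBox_iff (hℓ : 0 < ℓ) {x : E4} : x ∈ latBox ℓ b ↔ floorIdx ℓ x = b := by
  simp only [latBox, Set.mem_setOf_eq, floorIdx, funext_iff, Int.floor_eq_iff]
  refine forall_congr' fun i => ?_
  rw [le_div_iff₀ hℓ, div_lt_iff₀ hℓ]
  constructor <;> rintro ⟨h1, h2⟩ <;> constructor <;> linarith

/-- The box as the preimage of a coordinate box of `ℝ⁴`. [cite: Federbush1987PhaseCellVI, (10) p. 20] -/
theorem latBox_eq_preimage (ℓ : ℝ) (b : Fin 4 → ℤ) :
    latBox ℓ b = (fun x : E4 => WithLp.ofLp x) ⁻¹' Set.univ.pi fun i => Ico (ℓ * b i) (ℓ * (b i + 1)) := by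
  ext x
  simp [latBox, Set.mem_pi]

/-- Lattice boxes are measurable. [cite: Federbush1987PhaseCellVI, (10) p. 20] -/
theorem measurableSet_latBox : MeasurableSet (latBox ℓ b) := by
  rw [latBox_eq_preimage]
  exact (PiLp.continuous_ofLp 2 _).measurable (MeasurableSet.univ_pi fun i => measurableSet_Ico)

/-- `vol(ℓb + [0, ℓ)⁴) = ℓ⁴`. [cite: Federbush1987PhaseCellVI, (10) p. 20] -/
theorem volume_latBox (hℓ : 0 ≤ ℓ) (b : Fin 4 → ℤ) : volume (latBox ℓ b) = ENNReal.ofReal (ℓ ^ 4) := by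
  rw [latBox_eq_preimage, (PiLp.volume_preserving_ofLp (Fin 4)).measure_preimage
      (MeasurableSet.univ_pi fun i => measurableSet_Ico).nullMeasurableSet, Real.volume_pi_Ico]
  have : ∀ i : Fin 4, ℓ * ((b i : ℝ) + 1) - ℓ * (b i : ℝ) = ℓ := fun i => by ring
  simp only [this, Finset.prod_const, Finset.card_univ, Fintype.card_fin]
  rw [ENNReal.ofReal_pow hℓ]

/-! ## §2 The integral of a box-step function is `ℓ⁴ Σ_b c(b)` -/

/-- Box-step functions are measurable. [cite: Federbush1987PhaseCellVI, (10) p. 20] -/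
theorem measurable_stepFun : Measurable (stepFun ℓ c) :=
  (measurable_of_countable c).comp (measurable_floorIdx ℓ)

/-- A box-step function is the sum of the indicators of its boxes. [cite: Federbush1987PhaseCellVI, (10) p. 20] -/
theorem stepFun_eq_tsum_indicator (hℓ : 0 < ℓ) (x : E4) :
    stepFun ℓ c x = ∑' b, (latBox ℓ b).indicator (fun _ => c b) x := by
  rw [tsum_eq_single (floorIdx ℓ x)]
  · rw [indicator_of_mem ((mem_latBox_iff hℓ).2 rfl)]
    rfl
  · intro b hb
    exact indicator_of_notMem (fun hx => hb ((mem_latBox_iff hℓ).1 hx).symm) _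

/-- `∫⁻ ‖stepFun‖ₑ = Σ_b ‖c b‖ₑ ℓ⁴`. [cite: Federbush1987PhaseCellVI, (10) p. 20] -/
theorem lintegral_enorm_stepFun (hℓ : 0 < ℓ) :
    ∫⁻ x, ‖stepFun ℓ c x‖ₑ = ∑' b, ‖c b‖ₑ * ENNReal.ofReal (ℓ ^ 4) := by
  have h : ∀ x, (‖stepFun ℓ c x‖ₑ : ℝ≥0∞) =
      ∑' b, (latBox ℓ b).indicator (fun _ => (‖c b‖ₑ : ℝ≥0∞)) x := by
    intro x
    rw [tsum_eq_single (floorIdx ℓ x)]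
    · rw [indicator_of_mem ((mem_latBox_iff hℓ).2 rfl)]
      rfl
    · intro b hb
      exact indicator_of_notMem (fun hx => hb ((mem_latBox_iff hℓ).1 hx).symm) _
  simp_rw [h]
  rw [lintegral_tsum fun b => (measurable_const.indicator measurableSet_latBox).aemeasurable]
  congr 1
  ext b
  rw [lintegral_indicator_const measurableSet_latBox, volume_latBox hℓ.le]

/-- **The integral of an integrable box-step function is the lattice sum `Σ_b ℓ⁴ c(b)`** — the identity that turns a
plaquette sum into an integral over `ℝ⁴`. [cite: Federbush1987PhaseCellVI, (10) and Theorem 2 p. 20] -/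
theorem integral_stepFun (hℓ : 0 < ℓ) (hint : Integrable (stepFun ℓ c)) :
    ∫ x, stepFun ℓ c x = ∑' b, ℓ ^ 4 * c b := by
  have hae : ∀ b, AEStronglyMeasurable (fun x => (latBox ℓ b).indicator (fun _ => c b) x) volume :=
    fun b => aestronglyMeasurable_const.indicator measurableSet_latBox
  have hlin : ∀ b, ∫⁻ x, ‖(latBox ℓ b).indicator (fun _ => c b) x‖ₑ = ‖c b‖ₑ * ENNReal.ofReal (ℓ ^ 4) := by
    intro b
    have : ∀ x, ‖(latBox ℓ b).indicator (fun _ => c b) x‖ₑ =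
        (latBox ℓ b).indicator (fun _ => (‖c b‖ₑ : ℝ≥0∞)) x := by
      intro x
      by_cases hx : x ∈ latBox ℓ b <;> simp [hx]
    simp_rw [this]
    rw [lintegral_indicator_const measurableSet_latBox, volume_latBox hℓ.le]
  have hfin : ∑' b, ∫⁻ x, ‖(latBox ℓ b).indicator (fun _ => c b) x‖ₑ ≠ ∞ := by
    simp_rw [hlin]
    rw [← lintegral_enorm_stepFun hℓ]
    exact hint.hasFiniteIntegral.ne
  have hfun : (fun x => stepFun ℓ c x) = fun x => ∑' b, (latBox ℓ b).indicator (fun _ => c b) x :=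
    funext (stepFun_eq_tsum_indicator hℓ)
  rw [hfun, integral_tsum hae hfin]
  congr 1
  ext b
  rw [integral_indicator_const _ measurableSet_latBox, measureReal_def, volume_latBox hℓ.le b,
    ENNReal.toReal_ofReal (by positivity), smul_eq_mul]

/-! ## §3 Dominated convergence of lattice sums -/

/-- **Lattice sums converge to the integral under an integrable envelope.**  If the box-step functions `x ↦ c_n(⌊x/ℓ_n⌋)`
converge pointwise to `F` and are dominated by an integrable `G`, then `Σ_b ℓ_n⁴ c_n(b) → ∫ F` — the analytic core of
«the corresponding lattice actions, S^r_0, converge to the continuum action as r → ∞». [cite: Federbush1987PhaseCellVI,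
Theorem 2 p. 20; Federbush1986PhaseCellI, §4 p. 329] -/
theorem tendsto_latticeSum_of_dominated (ℓ : ℕ → ℝ) (hℓ : ∀ n, 0 < ℓ n) (c : ℕ → (Fin 4 → ℤ) → ℝ)
    (F G : E4 → ℝ) (hG : Integrable G) (hdom : ∀ n x, |c n (floorIdx (ℓ n) x)| ≤ G x)
    (hlim : ∀ x, Tendsto (fun n => c n (floorIdx (ℓ n) x)) atTop (𝓝 (F x))) :
    Tendsto (fun n => ∑' b, ℓ n ^ 4 * c n b) atTop (𝓝 (∫ x, F x)) := by
  have hmeas : ∀ n, AEStronglyMeasurable (stepFun (ℓ n) (c n)) volume :=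
    fun n => measurable_stepFun.aestronglyMeasurable
  have hbd : ∀ n, ∀ᵐ x ∂volume, ‖stepFun (ℓ n) (c n) x‖ ≤ G x :=
    fun n => Eventually.of_forall fun x => by rw [Real.norm_eq_abs]; exact hdom n x
  have hint : ∀ n, Integrable (stepFun (ℓ n) (c n)) := fun n => hG.mono' (hmeas n) (hbd n)
  have hconv := tendsto_integral_of_dominated_convergence G hmeas hG hbd (Eventually.of_forall hlim)
  exact Tendsto.congr (fun n => integral_stepFun (hℓ n) (hint n)) hconv

/-! ## §4 The continuous case with a radial envelope -/

/-- Coordinates of `x − ℓ⌊x/ℓ⌋` lie in `[0, ℓ)`. [cite: Federbush1987PhaseCellVI, (10) p. 20] -/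
theorem sub_cornerPt_apply (ℓ : ℝ) (x : E4) (i : Fin 4) :
    (x - cornerPt ℓ (floorIdx ℓ x)) i = x i - ℓ * (⌊x i / ℓ⌋ : ℤ) := by
  simp [cornerPt, mkPt, floorIdx]

/-- `‖x − ℓ⌊x/ℓ⌋‖ ≤ 2ℓ`. [cite: Federbush1987PhaseCellVI, (10) p. 20] -/
theorem norm_sub_cornerPt_le (hℓ : 0 < ℓ) (x : E4) : ‖x - cornerPt ℓ (floorIdx ℓ x)‖ ≤ 2 * ℓ := by
  have hi : ∀ i, ‖(x - cornerPt ℓ (floorIdx ℓ x)) i‖ ^ 2 ≤ ℓ ^ 2 := by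
    intro i
    rw [sub_cornerPt_apply, Real.norm_eq_abs, sq_abs]
    have h1 : (⌊x i / ℓ⌋ : ℝ) ≤ x i / ℓ := Int.floor_le _
    have h2 : x i / ℓ < (⌊x i / ℓ⌋ : ℝ) + 1 := Int.lt_floor_add_one _
    rw [div_lt_iff₀ hℓ] at h2
    rw [le_div_iff₀ hℓ] at h1
    have h3 : 0 ≤ x i - ℓ * (⌊x i / ℓ⌋ : ℝ) := by linarith
    have h4 : x i - ℓ * (⌊x i / ℓ⌋ : ℝ) ≤ ℓ := by linarith
    nlinarith
  rw [EuclideanSpace.norm_eq]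
  calc Real.sqrt (∑ i, ‖(x - cornerPt ℓ (floorIdx ℓ x)) i‖ ^ 2)
      ≤ Real.sqrt (∑ _i : Fin 4, ℓ ^ 2) := Real.sqrt_le_sqrt (Finset.sum_le_sum fun i _ => hi i)
    _ = 2 * ℓ := by
        rw [Finset.sum_const, Finset.card_univ, Fintype.card_fin, nsmul_eq_mul,
          show ((4 : ℕ) : ℝ) * ℓ ^ 2 = (2 * ℓ) ^ 2 by push_cast; ring, Real.sqrt_sq (by positivity)]

/-- `ℓ_r = 2^{−r} > 0`. [folklore] -/
private theorem latLen_pos_aux (r : ℕ) : 0 < latLen r := by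
  unfold latLen; positivity

/-- `ℓ_r ≤ 1`. [folklore] -/
private theorem latLen_le_one_aux (r : ℕ) : latLen r ≤ 1 := by
  unfold latLen
  exact inv_le_one_of_one_le₀ (one_le_pow₀ (by norm_num))

/-- `ℓ_r → 0`. [folklore] -/
private theorem tendsto_latLen_aux : Tendsto latLen atTop (𝓝 0) := by
  unfold latLen
  exact tendsto_inv_atTop_zero.comp (tendsto_pow_atTop_atTop_of_one_lt one_lt_two)

/-- The lattice points `ℓ_r⌊x/ℓ_r⌋` converge to `x`. [cite: Federbush1987PhaseCellVI, (10)–(12) p. 20] -/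
theorem tendsto_cornerPt (x : E4) :
    Tendsto (fun r => cornerPt (latLen r) (floorIdx (latLen r) x)) atTop (𝓝 x) := by
  rw [tendsto_iff_norm_sub_tendsto_zero]
  refine squeeze_zero (fun r => norm_nonneg _) (fun r => ?_)
    (by simpa using tendsto_latLen_aux.const_mul 2)
  rw [norm_sub_rev]
  exact norm_sub_cornerPt_le (latLen_pos_aux r) x

/-- **Riemann sums of a continuous function with an integrable radial envelope.**  If `h` is continuous,
`|h(y)| ≤ g(‖y‖)` with `g` antitone and `x ↦ g(‖x‖ − 2)` integrable on `ℝ⁴`, then `Σ_{b∈ℤ⁴} ℓ_r⁴ h(ℓ_r b) → ∫ h` as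
`r → ∞` (e.g. Theorem 2's hypothesis «A_μ(x) and its first partials fall off at infinity faster than 1/x^{2+ε}» makes the
continuum density dominated by `c(1 ∧ |x|^{−(4+2ε)})`). [cite: Federbush1987PhaseCellVI, Theorem 2 p. 20;
Federbush1986PhaseCellI, §4 p. 329] -/
theorem tendsto_latticeSum_continuous (h : E4 → ℝ) (hc : Continuous h) (g : ℝ → ℝ) (hg : Antitone g)
    (hdom : ∀ y, |h y| ≤ g ‖y‖) (hint : Integrable fun x : E4 => g (‖x‖ - 2)) :
    Tendsto (fun r => ∑' b, latLen r ^ 4 * h (cornerPt (latLen r) b)) atTop (𝓝 (∫ x, h x)) := by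
  refine tendsto_latticeSum_of_dominated (fun r => latLen r) (fun r => latLen_pos_aux r)
    (fun r b => h (cornerPt (latLen r) b)) h (fun x => g (‖x‖ - 2)) hint ?_ ?_
  · intro r x
    refine (hdom _).trans (hg ?_)
    have h1 := norm_sub_cornerPt_le (latLen_pos_aux r) x
    have h2 := latLen_le_one_aux r
    have h3 : ‖x‖ ≤ ‖x - cornerPt (latLen r) (floorIdx (latLen r) x)‖ +
        ‖cornerPt (latLen r) (floorIdx (latLen r) x)‖ := by
      simpa using norm_add_le (x - cornerPt (latLen r) (floorIdx (latLen r) x))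
        (cornerPt (latLen r) (floorIdx (latLen r) x))
    linarith
  · intro x
    exact (hc.tendsto x).comp (tendsto_cornerPt x)

end LatticeRiemann

end

end Literature.MathematicalPhysics.QuantumFieldTheory.Federbush1986
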